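import Literature.Analysis.FluidPDE.FujitaKatoPicard
import Literature.Analysis.FunctionSpaces.SobolevProductLawFourier
import Mathlib.MeasureTheory.Constructions.Polish.StronglyMeasurable
import Mathlib.MeasureTheory.Integral.DominatedConvergence
import HarnessLib

/-!
# The Fujita–Kato solution on the Fourier side: limit of the Picard iteration

Fourth layer and Fourier-side assembly of the discharge programme for the named fact
`Literature.Analysis.FluidPDE.fujita_kato_local` (plan: `Literature/Analysis/FluidPDE/FujitaKatoLocal.lean`;
source: P. G. Lemarié-Rieusset, *The Navier–Stokes problem in the 21st century*, 2nd ed., §8.8,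
PDF pp. 207–210 of the held copy). With the dominated Picard iteration of
`FujitaKatoPicard.lean` (`v_n = picard c a n`, envelope `M = fkEnv c T a`, difference majorants
`E_n = diffIter κ M M n`) this file proves `fourier_fujitaKato_local`:

1. the product law `Ḣ¹ · Ḣ¹ ⊂ Ḣ^{1/2}` in dimension three (`SobolevProductLawFourier.lean`) is the
   hypothesis `HasProductLaw` of the majorant layer with `K = (48 |B(0,1)|)^{1/2}` (`hasProductLaw`);
2. **smallness** (PDF p. 210, `lim_{T→0⁺} ‖sup_{0<t<T} t^{1/4} e^{-νt|ξ|²} |W₀(ξ)|‖_F = 0`): for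
   `a ∈ L²(|ξ| dξ)` the `F`-norm of the initial envelope `initEnv c T a` tends to `0` with `T`
   (dominated convergence), so the contraction condition `8 κ K ‖M₀‖_F ≤ 1` holds for small
   `T > 0` (`exists_small_time`);
3. under that condition `M`, `M ⋆ M` and `∑ E_n` are finite almost everywhere, the iterates
   converge at every such frequency for every `t ∈ [0, T]` ("by dominated convergence, we find
   that `U^{[n]}` converges to a limit `U^{[∞]}`", PDF p. 208) to `v = fkLimit c a`, jointly
   measurable in `(t, ξ)` (`StronglyMeasurable.limUnder`);
4. `v` solves the Duhamel formula ("`U^{[∞]} = U^{[0]} − B(U^{[∞]}, U^{[∞]})`", PDF p. 208;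
   dominated convergence in the convolution and in the time integral), inherits
   incompressibility and Hermitian symmetry, obeys the `L²`, `𝓕Ḣ^{1/2}` and `t^{1/4}`-weighted
   `𝓕Ḣ¹` bounds, and is continuous in `L²(dξ)` and `L²(|ξ| dξ)` on `[0, T]` (dominated
   convergence; the time continuity at a fixed frequency is that of the Duhamel integral);
5. `fourier_fujitaKato_local_holds`.

## Mathlib search

Used: `MeasureTheory.StronglyMeasurable.limUnder` (measurability of pointwise limits into a Polish
space, junk value elsewhere), `cauchySeq_of_edist_le_of_tsum_ne_top`, `tendsto_nhds_limUnder`,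
`tendsto_lintegral_of_dominated_convergence`, `tendsto_lintegral_filter_of_dominated_convergence`,
`tendsto_integral_of_dominated_convergence`, `continuousWithinAt_of_dominated`,
`intervalIntegral.integral_of_le`, `intervalIntegral.intervalIntegrable_rpow'`,
`measure_ball_lt_top`. No Mathlib fixed-point theorem is used: the contraction is the explicit
geometric domination of `FujitaKatoMajorant.lean`. Tree: on `[0, T]` the unclamped map
`duhamelMap` agrees with the sibling programme's clamped `FourierNS.duhamel`
(`duhamelMap_eq_duhamel`); the unclamped set-integral form is kept because it is jointly measurable
for all `t` without any continuity of the integrand.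

## References

* P. G. Lemarié-Rieusset, *The Navier–Stokes problem in the 21st century*, 2nd ed., CRC Press
  2023 (doi:10.1201/9781003042594), §8.8, PDF pp. 207–210; Thm. 7.4 (A), PDF p. 151.
  [Lemarierieusset2023]
* H. Fujita, T. Kato, *On the Navier–Stokes initial value problem. I*, Arch. Rational Mech.
  Anal. 16 (1964), 269–315. [FujitaKato1964]
-/

noncomputable section

open MeasureTheory Set Function Filter Topology Real Metric
open scoped ENNReal NNReal ComplexConjugate

namespace Literature.Analysis.FluidPDE.FujitaKato

open FourierNS Literature.Analysis.FunctionSpaces.FourierProductLaw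

variable {ι : Type*} [Fintype ι]

/-! ### The product law constant -/

section ProductLaw

variable (ι) in
/-- The product-law constant `K = (48 |B(0,1)|)^{1/2}` of
`Literature.Analysis.FunctionSpaces.FourierProductLaw.lintegral_enorm_mul_lconv_sq_le`. [cite: Lemarierieusset2023, Lemma 7.3 (7.14)] -/
def plK : ℝ≥0∞ :=
  (48 * volume (ball (0 : EuclideanSpace ℝ ι) 1)) ^ (1 / 2 : ℝ)

/-- `K² = 48 |B(0,1)|`. [folklore] -/
theorem plK_sq : plK ι ^ 2 = 48 * volume (ball (0 : EuclideanSpace ℝ ι) 1) := by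
  rw [plK, ← ENNReal.rpow_natCast, ← ENNReal.rpow_mul]
  norm_num

/-- `K ≠ ∞` (balls have finite Lebesgue measure). [folklore] -/
theorem plK_ne_top : plK ι ≠ ∞ :=
  ENNReal.rpow_ne_top_of_nonneg (by norm_num)
    (ENNReal.mul_ne_top (by norm_num) measure_ball_lt_top.ne)

/-- **The product law in dimension three** as the hypothesis `HasProductLaw` of the majorant
layer: `∫⁻ ‖ξ‖ (A ⋆ B)² ≤ K² ‖A‖_F² ‖B‖_F²` with `K² = 48 |B(0,1)|`
(`lintegral_enorm_mul_lconv_sq_le`; Lemarié-Rieusset 2023, Lemma 7.3 (7.14) with `s = δ = 1`,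
PDF p. 145, and §8.8, PDF p. 209). [cite: Lemarierieusset2023, Lemma 7.3 (7.14) and §8.8 (PDF p. 209)] -/
theorem hasProductLaw (hE : Module.finrank ℝ (EuclideanSpace ℝ ι) = 3) :
    HasProductLaw (EuclideanSpace ℝ ι) (plK ι) := by
  intro A B hA hB
  rw [plK_sq]
  simpa only [lconv_apply] using lintegral_enorm_mul_lconv_sq_le hE hA hB

end ProductLaw

/-! ### Smallness of the initial envelope for small times -/

section Smallness

variable {c T : ℝ} {a : EuclideanSpace ℝ ι → ι → ℂ}

/-- `ofReal (x) ^ 2 = ofReal (x ^ 2)` for the real powers met below. [folklore] -/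
theorem ofReal_rpow_sq {x : ℝ} (hx : 0 < x) (p : ℝ) :
    ENNReal.ofReal (x ^ p) ^ 2 = ENNReal.ofReal (x ^ (2 * p)) := by
  rw [← ENNReal.ofReal_pow (Real.rpow_nonneg hx.le _), ← Real.rpow_natCast,
    ← Real.rpow_mul hx.le, mul_comm]
  norm_num

/-- The uniform bound `‖ξ‖² M₀(ξ)² ≤ c^{-1/2} ‖ξ‖ |a(ξ)|²` (`‖ξ‖² w(ξ)² = ‖ξ‖`). [folklore] -/
theorem sq_mul_initEnv_sq_le (hc : 0 < c) (T : ℝ) (a : EuclideanSpace ℝ ι → ι → ℂ)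
    (ξ : EuclideanSpace ℝ ι) :
    ‖ξ‖ₑ ^ 2 * initEnv c T a ξ ^ 2 ≤ ENNReal.ofReal (c ^ (-(1 / 2 : ℝ))) * (‖ξ‖ₑ * ‖a ξ‖ₑ ^ 2) := by
  calc ‖ξ‖ₑ ^ 2 * initEnv c T a ξ ^ 2
      ≤ ‖ξ‖ₑ ^ 2 * (‖a ξ‖ₑ * (ENNReal.ofReal (c ^ (-(1 / 4 : ℝ))) * weight ξ)) ^ 2 := by
        gcongr
        exact initEnv_le_right c T a ξ
    _ = ENNReal.ofReal (c ^ (-(1 / 4 : ℝ))) ^ 2 * (‖ξ‖ₑ ^ 2 * weight ξ ^ 2) * ‖a ξ‖ₑ ^ 2 := by ring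
    _ = ENNReal.ofReal (c ^ (-(1 / 2 : ℝ))) * (‖ξ‖ₑ * ‖a ξ‖ₑ ^ 2) := by
        rw [enorm_sq_mul_weight_sq, ofReal_rpow_sq hc]
        norm_num
        ring

/-- The small-time bound `‖ξ‖² M₀(ξ)² ≤ T^{1/2} ‖ξ‖² |a(ξ)|²`. [folklore] -/
theorem sq_mul_initEnv_sq_le' (hT : 0 < T) (c : ℝ) (a : EuclideanSpace ℝ ι → ι → ℂ)
    (ξ : EuclideanSpace ℝ ι) :
    ‖ξ‖ₑ ^ 2 * initEnv c T a ξ ^ 2 ≤ ENNReal.ofReal (T ^ (1 / 2 : ℝ)) * (‖ξ‖ₑ ^ 2 * ‖a ξ‖ₑ ^ 2) := by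
  calc ‖ξ‖ₑ ^ 2 * initEnv c T a ξ ^ 2
      ≤ ‖ξ‖ₑ ^ 2 * (‖a ξ‖ₑ * ENNReal.ofReal (T ^ (1 / 4 : ℝ))) ^ 2 := by
        gcongr
        exact initEnv_le_left c T a ξ
    _ = ENNReal.ofReal (T ^ (1 / 4 : ℝ)) ^ 2 * (‖ξ‖ₑ ^ 2 * ‖a ξ‖ₑ ^ 2) := by ring
    _ = ENNReal.ofReal (T ^ (1 / 2 : ℝ)) * (‖ξ‖ₑ ^ 2 * ‖a ξ‖ₑ ^ 2) := by
        rw [ofReal_rpow_sq hT]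
        norm_num

/-- `‖M₀‖_F² ≤ c^{-1/2} ∫⁻ ‖ξ‖ |a|²`: the initial envelope lies in `F` as soon as
`a ∈ L²(|ξ| dξ)`. [cite: Lemarierieusset2023, §8.8 (PDF p. 210)] -/
theorem fnorm_initEnv_sq_le (hc : 0 < c) (T : ℝ) (a : EuclideanSpace ℝ ι → ι → ℂ) :
    fnorm (initEnv c T a) ^ 2 ≤ ENNReal.ofReal (c ^ (-(1 / 2 : ℝ))) * ∫⁻ ξ, ‖ξ‖ₑ * ‖a ξ‖ₑ ^ 2 := by
  rw [fnorm_sq, ← lintegral_const_mul' _ _ ENNReal.ofReal_ne_top]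
  exact lintegral_mono fun ξ => sq_mul_initEnv_sq_le hc T a ξ

/-- **Smallness of the initial envelope for small times** (Lemarié-Rieusset 2023, §8.8, PDF
p. 210: `lim_{T→0⁺} ‖sup_{0<t<T} t^{1/4} e^{-νt|ξ|²} |W₀(ξ)|‖_F = 0` for `W₀ ∈ E = L²(|ξ| dξ)`):
for measurable `a` with `∫⁻ ‖ξ‖ |a|² < ∞` and every `δ > 0` there is `T > 0` with
`‖initEnv c T a‖_F ≤ δ` (dominated convergence along `T = 1/(m+1)`). [cite: Lemarierieusset2023, §8.8 (PDF p. 210)] -/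
theorem exists_small_time (hc : 0 < c) (ha : Measurable a)
    (haE : ∫⁻ ξ, ‖ξ‖ₑ * ‖a ξ‖ₑ ^ 2 < ∞) {δ : ℝ≥0∞} (hδ : 0 < δ) :
    ∃ T : ℝ, 0 < T ∧ fnorm (initEnv c T a) ≤ δ := by
  -- the integrands along `T_m = 1/(m+1)` and their dominating function
  set g : ℕ → EuclideanSpace ℝ ι → ℝ≥0∞ := fun m ξ =>
    ‖ξ‖ₑ ^ 2 * initEnv c (1 / ((m : ℝ) + 1)) a ξ ^ 2 with hg
  set G : EuclideanSpace ℝ ι → ℝ≥0∞ := fun ξ =>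
    ENNReal.ofReal (c ^ (-(1 / 2 : ℝ))) * (‖ξ‖ₑ * ‖a ξ‖ₑ ^ 2) with hG
  have hTm : ∀ m : ℕ, (0 : ℝ) < 1 / ((m : ℝ) + 1) := fun m => by positivity
  have hg_meas : ∀ m, Measurable (g m) := fun m =>
    (measurable_id.enorm.pow_const _).mul ((measurable_initEnv ha c _).pow_const _)
  have hg_le : ∀ m, g m ≤ᵐ[volume] G := fun m => ae_of_all _ fun ξ => sq_mul_initEnv_sq_le hc _ a ξ
  have hG_fin : ∫⁻ ξ, G ξ ≠ ∞ := by
    rw [hG, lintegral_const_mul' _ _ ENNReal.ofReal_ne_top]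
    exact ENNReal.mul_ne_top ENNReal.ofReal_ne_top haE.ne
  -- pointwise convergence to `0`
  have hg_lim : ∀ᵐ ξ ∂(volume : Measure (EuclideanSpace ℝ ι)), Tendsto (fun m => g m ξ) atTop (𝓝 0) := by
    refine ae_of_all _ fun ξ => ?_
    have hfin : ‖ξ‖ₑ ^ 2 * ‖a ξ‖ₑ ^ 2 ≠ ∞ :=
      ENNReal.mul_ne_top (ENNReal.pow_ne_top enorm_ne_top) (ENNReal.pow_ne_top enorm_ne_top)
    have h1 : Tendsto (fun m : ℕ => ENNReal.ofReal ((1 / ((m : ℝ) + 1)) ^ (1 / 2 : ℝ))) atTop (𝓝 0) := by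
      have h := tendsto_one_div_add_atTop_nhds_zero_nat (𝕜 := ℝ)
      have h' : Tendsto (fun m : ℕ => (1 / ((m : ℝ) + 1)) ^ (1 / 2 : ℝ)) atTop (𝓝 ((0 : ℝ) ^ (1 / 2 : ℝ))) :=
        ((Real.continuous_rpow_const (by norm_num : (0 : ℝ) ≤ 1 / 2)).tendsto 0).comp h
      rw [Real.zero_rpow (by norm_num)] at h'
      simpa using ENNReal.tendsto_ofReal h'
    have h2 : Tendsto (fun m : ℕ => ENNReal.ofReal ((1 / ((m : ℝ) + 1)) ^ (1 / 2 : ℝ)) *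
        (‖ξ‖ₑ ^ 2 * ‖a ξ‖ₑ ^ 2)) atTop (𝓝 0) := by
      simpa using ENNReal.Tendsto.mul_const h1 (Or.inr hfin)
    refine tendsto_of_tendsto_of_tendsto_of_le_of_le tendsto_const_nhds h2 (fun m => zero_le) fun m => ?_
    exact sq_mul_initEnv_sq_le' (hTm m) c a ξ
  have hlim := tendsto_lintegral_of_dominated_convergence G hg_meas hg_le hG_fin hg_lim
  rw [lintegral_zero] at hlim
  -- pick `m` with `∫⁻ g_m < δ²`
  have hδ2 : (0 : ℝ≥0∞) < δ ^ 2 := ENNReal.pow_pos hδ 2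
  obtain ⟨m, hm⟩ := (eventually_atTop.1 ((tendsto_order.1 hlim).2 _ hδ2))
  refine ⟨1 / ((m : ℝ) + 1), hTm m, ?_⟩
  have h := hm m le_rfl
  rw [← fnorm_sq] at h
  exact (ENNReal.pow_le_pow_left_iff two_ne_zero).1 h.le

end Smallness

/-! ### The standing hypotheses and their consequences -/

section Hypotheses

variable {c T : ℝ} {a : EuclideanSpace ℝ ι → ι → ℂ}

/-- **Standing hypotheses of the construction** on the time interval `[0, T]`: dimension three, a
rate `c > 0`, measurable Fourier data `a ∈ L²(dξ) ∩ L²(|ξ| dξ)`, and the contraction condition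
`8 κ K ‖M₀‖_F ≤ 1` on the initial envelope (which holds for small `T`, `exists_small_time`). [cite: Lemarierieusset2023, §8.8 (PDF pp. 209–210)] -/
structure FKHyp (c T : ℝ) (a : EuclideanSpace ℝ ι → ι → ℂ) : Prop where
  /-- Frequency space is three-dimensional. -/
  finrank_eq : Module.finrank ℝ (EuclideanSpace ℝ ι) = 3
  /-- The heat rate is positive. -/
  c_pos : 0 < c
  /-- The time horizon is positive. -/
  T_pos : 0 < T
  /-- The datum is measurable. -/
  measurable : Measurable a
  /-- `a ∈ L²(dξ)`. -/
  sq_lt_top : ∫⁻ ξ, ‖a ξ‖ₑ ^ 2 < ∞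
  /-- `a ∈ L²(|ξ| dξ)`. -/
  weighted_lt_top : ∫⁻ ξ, ‖ξ‖ₑ * ‖a ξ‖ₑ ^ 2 < ∞
  /-- The contraction condition on the initial envelope. -/
  small : 8 * kappa ι c * plK ι * fnorm (initEnv c T a) ≤ 1

namespace FKHyp

variable (h : FKHyp c T a)
include h

/-- `card ι = 3`. [folklore] -/
theorem card_eq : Fintype.card ι = 3 := by
  have := h.finrank_eq
  rwa [finrank_euclideanSpace] at this

/-- The index type is nonempty. [folklore] -/
theorem nonempty : Nonempty ι := by
  have h3 := h.card_eq
  exact Fintype.card_pos_iff.1 (by omega)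

/-- Frequency space is nontrivial. [folklore] -/
theorem nontrivial : Nontrivial (EuclideanSpace ℝ ι) :=
  nontrivial_of_finrank_eq_three h.finrank_eq

/-- `‖M₀‖_F < ∞`. [folklore] -/
theorem fnorm_initEnv_lt_top : fnorm (initEnv c T a) < ∞ := by
  have h1 : fnorm (initEnv c T a) ^ 2 < ∞ :=
    lt_of_le_of_lt (fnorm_initEnv_sq_le h.c_pos T a)
      (ENNReal.mul_lt_top ENNReal.ofReal_lt_top h.weighted_lt_top)
  by_contra hc
  rw [not_lt, top_le_iff] at hc
  rw [hc, ENNReal.top_pow two_ne_zero] at h1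
  exact lt_irrefl _ h1

/-- **The two contraction inequalities**: `‖M‖_F ≤ 2 ‖M₀‖_F` and `2 κ K ‖M‖_F ≤ 1/2`
(`contraction_of_small`). [cite: Lemarierieusset2023, §8.8 (PDF p. 209)] -/
theorem contraction : fnorm (fkEnv c T a) ≤ 2 * fnorm (initEnv c T a) ∧
    2 * kappa ι c * plK ι * fnorm (fkEnv c T a) ≤ 2⁻¹ :=
  contraction_of_small (hasProductLaw h.finrank_eq) (measurable_initEnv h.measurable c T)
    (kappa_ne_top c) h.small

/-- `‖M‖_F < ∞`. [folklore] -/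
theorem fnorm_fkEnv_lt_top : fnorm (fkEnv c T a) < ∞ :=
  lt_of_le_of_lt h.contraction.1 (ENNReal.mul_lt_top (by norm_num) h.fnorm_initEnv_lt_top)

/-- The envelope is finite almost everywhere. [folklore] -/
theorem ae_fkEnv_lt_top : ∀ᵐ ξ ∂(volume : Measure (EuclideanSpace ℝ ι)), fkEnv c T a ξ < ∞ := by
  haveI := h.nontrivial
  exact ae_lt_top_of_fnorm_lt_top (measurable_fkEnv h.measurable c T) h.fnorm_fkEnv_lt_top

/-- The envelope convolution `M ⋆ M` is finite almost everywhere. [folklore] -/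
theorem ae_lconv_lt_top : ∀ᵐ ξ ∂(volume : Measure (EuclideanSpace ℝ ι)),
    lconv (fkEnv c T a) (fkEnv c T a) ξ < ∞ := by
  haveI := h.nonempty
  exact h.ae_fkEnv_lt_top.mono fun ξ hξ =>
    lconv_majorant_lt_top (measurable_initEnv h.measurable c T) (kappa_ne_zero h.c_pos) hξ

/-- `‖∑ E_n‖_F ≤ 2 ‖M‖_F < ∞`. [folklore] -/
theorem fnorm_tsum_diffIter_lt_top :
    fnorm (fun ξ => ∑' n, diffIter (kappa ι c) (fkEnv c T a) (fkEnv c T a) n ξ) < ∞ := by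
  have hM := measurable_fkEnv h.measurable c T
  refine lt_of_le_of_lt (fnorm_tsum_diffIter_le (hasProductLaw h.finrank_eq) hM hM (kappa_ne_top c)
    h.contraction.2) ?_
  exact ENNReal.mul_lt_top (by norm_num) h.fnorm_fkEnv_lt_top

/-- `∑ E_n` is finite almost everywhere. [folklore] -/
theorem ae_tsum_diffIter_lt_top : ∀ᵐ ξ ∂(volume : Measure (EuclideanSpace ℝ ι)),
    ∑' n, diffIter (kappa ι c) (fkEnv c T a) (fkEnv c T a) n ξ < ∞ := by
  haveI := h.nontrivial
  have hM := measurable_fkEnv h.measurable c T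
  exact ae_lt_top_of_fnorm_lt_top (Measurable.tsum (measurable_diffIter hM hM))
    h.fnorm_tsum_diffIter_lt_top

/-- `∫⁻ ‖ξ‖ (M ⋆ M)² ≤ K² ‖M‖_F⁴ < ∞` (the product law). [folklore] -/
theorem lintegral_enorm_mul_lconv_sq_lt_top :
    ∫⁻ ξ, ‖ξ‖ₑ * lconv (fkEnv c T a) (fkEnv c T a) ξ ^ 2 < ∞ := by
  have hM := measurable_fkEnv h.measurable c T
  refine lt_of_le_of_lt (hasProductLaw h.finrank_eq _ _ hM hM) ?_
  rw [← fnorm_sq]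
  have h1 : fnorm (fkEnv c T a) ^ 2 < ∞ := ENNReal.pow_lt_top h.fnorm_fkEnv_lt_top
  exact ENNReal.mul_lt_top (ENNReal.mul_lt_top (ENNReal.pow_lt_top plK_ne_top.lt_top) h1) h1

/-- `‖w · (M ⋆ M)‖_F < ∞`. [folklore] -/
theorem fnorm_weight_mul_lconv_lt_top :
    fnorm (fun ξ => weight ξ * lconv (fkEnv c T a) (fkEnv c T a) ξ) < ∞ := by
  have hM := measurable_fkEnv h.measurable c T
  refine lt_of_le_of_lt (fnorm_weight_mul_lconv_le (hasProductLaw h.finrank_eq) hM hM) ?_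
  exact ENNReal.mul_lt_top (ENNReal.mul_lt_top plK_ne_top.lt_top h.fnorm_fkEnv_lt_top)
    h.fnorm_fkEnv_lt_top

end FKHyp

/-- **The regular frequencies**: `(M ⋆ M)(ξ) < ∞` and `∑ E_n(ξ) < ∞`; almost every frequency is
regular under `FKHyp`, and at regular frequencies the Picard iterates converge for every
`t ∈ [0, T]`. [folklore] -/
def goodSet (c T : ℝ) (a : EuclideanSpace ℝ ι → ι → ℂ) : Set (EuclideanSpace ℝ ι) :=
  {ξ | lconv (fkEnv c T a) (fkEnv c T a) ξ < ∞ ∧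
    ∑' n, diffIter (kappa ι c) (fkEnv c T a) (fkEnv c T a) n ξ < ∞}

/-- Almost every frequency is regular. [folklore] -/
theorem FKHyp.ae_mem_goodSet (h : FKHyp c T a) :
    ∀ᵐ ξ ∂(volume : Measure (EuclideanSpace ℝ ι)), ξ ∈ goodSet c T a := by
  filter_upwards [h.ae_lconv_lt_top, h.ae_tsum_diffIter_lt_top] with ξ h1 h2
  exact ⟨h1, h2⟩

/-- Almost every frequency has a regular antipode. [folklore] -/
theorem FKHyp.ae_neg_mem_goodSet (h : FKHyp c T a) :
    ∀ᵐ ξ ∂(volume : Measure (EuclideanSpace ℝ ι)), -ξ ∈ goodSet c T a :=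
  (Measure.measurePreserving_neg (volume : Measure (EuclideanSpace ℝ ι))).quasiMeasurePreserving.ae
    h.ae_mem_goodSet

end Hypotheses

/-! ### The limit of the Picard iteration -/

section Limit

variable [DecidableEq ι] {c T : ℝ} {a : EuclideanSpace ℝ ι → ι → ℂ}

/-- **The Fujita–Kato solution on the Fourier side**: the pointwise limit
`v(t, ξ) = lim_n v_n(t, ξ)` of the Picard iterates (Lemarié-Rieusset 2023, §8.8, PDF p. 208,
`U^{[∞]}`); a junk value where the iterates do not converge (a null set of frequencies under
`FKHyp`, for `t ∈ [0, T]`). [cite: Lemarierieusset2023, §8.8 (PDF p. 208)] -/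
def fkLimit (c : ℝ) (a : EuclideanSpace ℝ ι → ι → ℂ) (t : ℝ) (ξ : EuclideanSpace ℝ ι) : ι → ℂ :=
  limUnder atTop fun n => picard c a n t ξ

/-- **Joint measurability of the limit** (`StronglyMeasurable.limUnder`). [folklore] -/
theorem measurable_fkLimit (ha : Measurable a) (c : ℝ) : Measurable (uncurry (fkLimit c a)) :=
  (MeasureTheory.StronglyMeasurable.limUnder (l := atTop) (f := fun n => uncurry (picard c a n))
    fun n => (measurable_picard ha n).stronglyMeasurable).measurable

/-- Measurability of a time slice of the limit. [folklore] -/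
theorem measurable_fkLimit_slice (ha : Measurable a) (c t : ℝ) : Measurable (fkLimit c a t) :=
  (measurable_fkLimit ha c).comp (f := fun ξ : EuclideanSpace ℝ ι => (t, ξ)) (by fun_prop)

/-- Measurability of the nonlinearity of the limit along a frequency slice. [folklore] -/
theorem measurable_nonlin_fkLimit (ha : Measurable a) (c : ℝ) (ξ : EuclideanSpace ℝ ι) :
    Measurable fun s => nonlin (fkLimit c a s) (fkLimit c a s) ξ :=
  (measurable_nonlin_uncurry (measurable_fkLimit ha c) (measurable_fkLimit ha c)).comp
    (f := fun s : ℝ => (s, ξ)) (by fun_prop)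

/-- For `t ≤ 0` the limit is the free evolution. [folklore] -/
theorem fkLimit_apply_of_nonpos {t : ℝ} (ht : t ≤ 0) (ξ : EuclideanSpace ℝ ι) :
    fkLimit c a t ξ = heat c ξ t • a ξ := by
  rw [fkLimit]
  simp_rw [picard_apply_of_nonpos ht]
  exact tendsto_const_nhds.limUnder_eq

/-- **The limit starts at the datum**: `v(0) = a`. [folklore] -/
@[simp]
theorem fkLimit_zero : fkLimit c a 0 = a := by
  funext ξ
  rw [fkLimit_apply_of_nonpos le_rfl ξ, heat_zero, one_smul]

/-- **Bridge to the sibling programme**: on `[0, T]` the unclamped Duhamel map `duhamelMap` of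
`FujitaKatoPicard.lean` is the tree's clamped `FourierNS.duhamel` (`NSFourierPicard.lean`); the
unclamped, set-integral form is used here because it is defined and jointly measurable for all
`t` without continuity of the integrand. [folklore] -/
theorem duhamelMap_eq_duhamel (c : ℝ) (a : EuclideanSpace ℝ ι → ι → ℂ) (v : ℝ → EuclideanSpace ℝ ι → ι → ℂ)
    {t : ℝ} (ht : t ∈ Icc 0 T) (ξ : EuclideanSpace ℝ ι) :
    duhamelMap c a v t ξ = FourierNS.duhamel c T a v t ξ := by
  rw [duhamelMap, FourierNS.duhamel, clamp_of_mem ht, intervalIntegral.integral_of_le ht.1]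

/-- **Convergence of the Picard iterates** at every regular frequency and every `t ∈ [0, T]`
(geometric Cauchy estimate `‖v_{n+1} − v_n‖ ≤ t^{-1/4} E_n`, `∑ E_n(ξ) < ∞`;
Lemarié-Rieusset 2023, §8.8, PDF p. 208). [cite: Lemarierieusset2023, §8.8 (PDF p. 208)] -/
theorem FKHyp.tendsto_picard (h : FKHyp c T a) {ξ : EuclideanSpace ℝ ι} (hξ : ξ ∈ goodSet c T a)
    {t : ℝ} (ht : t ∈ Icc 0 T) :
    Tendsto (fun n => picard c a n t ξ) atTop (𝓝 (fkLimit c a t ξ)) := by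
  refine tendsto_nhds_limUnder ?_
  rcases ht.1.eq_or_lt with rfl | ht0
  · exact ⟨a ξ, by simp⟩
  have htT : t ∈ Ioc 0 T := ⟨ht0, ht.2⟩
  refine cauchySeq_tendsto_of_complete (cauchySeq_of_edist_le_of_tsum_ne_top
    (fun n => ENNReal.ofReal (t ^ (-(1 / 4 : ℝ))) *
      diffIter (kappa ι c) (fkEnv c T a) (fkEnv c T a) n ξ) (fun n => ?_) ?_)
  · rw [edist_comm, edist_eq_enorm_sub]
    exact enorm_picard_succ_sub_le h.c_pos h.measurable h.ae_lconv_lt_top n t htT ξ hξ.1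
  · rw [ENNReal.tsum_mul_left]
    exact ENNReal.mul_ne_top ENNReal.ofReal_ne_top hξ.2.ne

/-- Componentwise convergence. [folklore] -/
theorem FKHyp.tendsto_picard_apply (h : FKHyp c T a) {ξ : EuclideanSpace ℝ ι} (hξ : ξ ∈ goodSet c T a)
    {t : ℝ} (ht : t ∈ Icc 0 T) (j : ι) :
    Tendsto (fun n => picard c a n t ξ j) atTop (𝓝 (fkLimit c a t ξ j)) :=
  (continuous_apply j).continuousAt.tendsto.comp (h.tendsto_picard hξ ht)

/-! ### Pointwise bounds of the limit -/

/-- **Domination of the limit**: `‖v(t, ξ)‖ ≤ t^{-1/4} M(ξ)` at regular frequencies. [cite: Lemarierieusset2023, §8.8 (PDF p. 209)] -/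
theorem FKHyp.enorm_fkLimit_le (h : FKHyp c T a) {ξ : EuclideanSpace ℝ ι} (hξ : ξ ∈ goodSet c T a)
    {t : ℝ} (ht : t ∈ Ioc 0 T) :
    ‖fkLimit c a t ξ‖ₑ ≤ ENNReal.ofReal (t ^ (-(1 / 4 : ℝ))) * fkEnv c T a ξ :=
  le_of_tendsto' (h.tendsto_picard hξ ⟨ht.1.le, ht.2⟩).enorm fun n =>
    enorm_picard_le h.c_pos h.measurable n t ht ξ

/-- The `𝓕Ḣ^{1/2}`-type bound of the limit: `‖v(t,ξ) − e^{-c‖ξ‖²t} a(ξ)‖ ≤ κ₁ (M ⋆ M)(ξ)`. [cite: Lemarierieusset2023, §8.8 (PDF p. 209)] -/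
theorem FKHyp.enorm_fkLimit_sub_free_le (h : FKHyp c T a) {ξ : EuclideanSpace ℝ ι}
    (hξ : ξ ∈ goodSet c T a) {t : ℝ} (ht : t ∈ Ioc 0 T) :
    ‖fkLimit c a t ξ - heat c ξ t • a ξ‖ₑ ≤ kappa₁ ι c * lconv (fkEnv c T a) (fkEnv c T a) ξ :=
  le_of_tendsto' ((h.tendsto_picard hξ ⟨ht.1.le, ht.2⟩).sub tendsto_const_nhds).enorm fun n =>
    enorm_picard_sub_free_le h.c_pos h.measurable n t ht ξ

/-- The `L²`-type bound of the limit: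
`‖v(t,ξ) − e^{-c‖ξ‖²t} a(ξ)‖ ≤ T^{1/4} κ₂ ‖ξ‖^{1/2} (M ⋆ M)(ξ)`. [cite: Lemarierieusset2023, §8.8 (PDF p. 209)] -/
theorem FKHyp.enorm_fkLimit_sub_free_le' (h : FKHyp c T a) {ξ : EuclideanSpace ℝ ι}
    (hξ : ξ ∈ goodSet c T a) {t : ℝ} (ht : t ∈ Ioc 0 T) :
    ‖fkLimit c a t ξ - heat c ξ t • a ξ‖ₑ ≤
      ENNReal.ofReal (T ^ (1 / 4 : ℝ)) *
        (kappa₂ ι c * (‖ξ‖ₑ * weight ξ) * lconv (fkEnv c T a) (fkEnv c T a) ξ) :=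
  le_of_tendsto' ((h.tendsto_picard hξ ⟨ht.1.le, ht.2⟩).sub tendsto_const_nhds).enorm fun n =>
    enorm_picard_sub_free_le' h.c_pos h.measurable n t ht ξ

/-- The domination of the limit, almost everywhere. [folklore] -/
theorem FKHyp.enorm_fkLimit_le_ae (h : FKHyp c T a) :
    ∀ t ∈ Ioc 0 T, ∀ᵐ η ∂(volume : Measure (EuclideanSpace ℝ ι)),
      ‖fkLimit c a t η‖ₑ ≤ ENNReal.ofReal (t ^ (-(1 / 4 : ℝ))) * fkEnv c T a η :=
  fun _ ht => h.ae_mem_goodSet.mono fun _ hη => h.enorm_fkLimit_le hη ht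

/-- The nonlinearity of the limit: `‖N(v(s), v(s))(ξ)‖ ≤ C_N ‖ξ‖ s^{-1/2} (M ⋆ M)(ξ)` on `(0, T]`,
at every frequency. [folklore] -/
theorem FKHyp.enorm_nonlin_fkLimit_le (h : FKHyp c T a) {s : ℝ} (hs : s ∈ Ioc 0 T)
    (ξ : EuclideanSpace ℝ ι) :
    ‖nonlin (fkLimit c a s) (fkLimit c a s) ξ‖ₑ ≤
      nonlinC ι * ‖ξ‖ₑ * (ENNReal.ofReal (s ^ (-(1 / 2 : ℝ))) * lconv (fkEnv c T a) (fkEnv c T a) ξ) := by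
  rw [← ofReal_rpow_quarter_mul_self hs.1]
  exact enorm_nonlin_le_of_dominated ENNReal.ofReal_ne_top (h.enorm_fkLimit_le_ae s hs) ξ

/-! ### The Duhamel formula in the limit -/

omit [Fintype ι] [DecidableEq ι] in
/-- From an `ℝ≥0∞` bound of the norm to a real one. [folklore] -/
theorem norm_le_toReal_of_enorm_le {X : Type*} [NormedAddCommGroup X] {x : X} {B : ℝ≥0∞}
    (hB : B ≠ ∞) (h : ‖x‖ₑ ≤ B) : ‖x‖ ≤ B.toReal := by
  rw [← toReal_enorm]
  exact ENNReal.toReal_mono hB h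

/-- **Convergence of the convolutions** `(v_{n,j} ⋆ v_{n,k})(ξ) → (v_j ⋆ v_k)(ξ)` at a regular
frequency, `0 < s ≤ T` (dominated convergence in `η`: domination by `s^{-1/2} M(ξ-η) M(η)`, whose
integral is `s^{-1/2} (M ⋆ M)(ξ) < ∞`; convergence at a.e. `η`). [cite: Lemarierieusset2023, §8.8 (PDF p. 208)] -/
theorem FKHyp.tendsto_fconv_picard (h : FKHyp c T a) {ξ : EuclideanSpace ℝ ι} (hξ : ξ ∈ goodSet c T a)
    {s : ℝ} (hs : s ∈ Ioc 0 T) (j k : ι) :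
    Tendsto (fun n => fconv (picard c a n s · j) (picard c a n s · k) ξ) atTop
      (𝓝 (fconv (fkLimit c a s · j) (fkLimit c a s · k) ξ)) := by
  simp_rw [fconv_apply]
  set M := fkEnv c T a with hM
  have hMm : Measurable M := measurable_fkEnv h.measurable c T
  set lam : ℝ≥0∞ := ENNReal.ofReal (s ^ (-(1 / 4 : ℝ))) with hlam
  have hlam_top : lam ≠ ∞ := ENNReal.ofReal_ne_top
  set b : EuclideanSpace ℝ ι → ℝ := fun η => (lam * M (ξ - η) * (lam * M η)).toReal with hb
  have hsub : Measurable fun η : EuclideanSpace ℝ ι => ξ - η := measurable_const.sub measurable_id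
  refine tendsto_integral_of_dominated_convergence b (fun n => ?_) ?_ (fun n => ?_) ?_
  · exact (((measurable_pi_apply j).comp (measurable_picard_slice h.measurable n s)).mul
      ((measurable_pi_apply k).comp ((measurable_picard_slice h.measurable n s).comp hsub))).aestronglyMeasurable
  · refine ⟨(((measurable_const.mul (hMm.comp hsub)).mul
      (measurable_const.mul hMm)).ennreal_toReal).aestronglyMeasurable, ?_⟩
    rw [hasFiniteIntegral_iff_enorm]
    calc ∫⁻ η, ‖b η‖ₑ ≤ ∫⁻ η, lam * M (ξ - η) * (lam * M η) := lintegral_mono fun η => by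
            rw [hb, Real.enorm_eq_ofReal ENNReal.toReal_nonneg]
            exact ENNReal.ofReal_toReal_le
      _ = lam * lam * lconv M M ξ := by
          rw [lconv_apply, ← lintegral_const_mul' _ _ (ENNReal.mul_ne_top hlam_top hlam_top)]
          congr 1
          funext η
          ring
      _ < ∞ := ENNReal.mul_lt_top (ENNReal.mul_lt_top hlam_top.lt_top hlam_top.lt_top) hξ.1
  · filter_upwards [h.ae_fkEnv_lt_top,
      (Measure.measurePreserving_sub_left volume ξ).quasiMeasurePreserving.ae h.ae_fkEnv_lt_top]
      with η h1 h2
    have e1 : ‖picard c a n s η j‖ ≤ (lam * M η).toReal :=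
      norm_le_toReal_of_enorm_le (ENNReal.mul_ne_top hlam_top h1.ne)
        ((enorm_apply_le_enorm _ j).trans (enorm_picard_le h.c_pos h.measurable n s hs η))
    have e2 : ‖picard c a n s (ξ - η) k‖ ≤ (lam * M (ξ - η)).toReal :=
      norm_le_toReal_of_enorm_le (ENNReal.mul_ne_top hlam_top h2.ne)
        ((enorm_apply_le_enorm _ k).trans (enorm_picard_le h.c_pos h.measurable n s hs (ξ - η)))
    rw [norm_mul, hb]
    dsimp only
    rw [ENNReal.toReal_mul]
    calc ‖picard c a n s η j‖ * ‖picard c a n s (ξ - η) k‖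
        ≤ (lam * M η).toReal * (lam * M (ξ - η)).toReal :=
          mul_le_mul e1 e2 (norm_nonneg _) ENNReal.toReal_nonneg
      _ = (lam * M (ξ - η)).toReal * (lam * M η).toReal := mul_comm _ _
  · filter_upwards [h.ae_mem_goodSet,
      (Measure.measurePreserving_sub_left volume ξ).quasiMeasurePreserving.ae h.ae_mem_goodSet]
      with η h1 h2
    exact (h.tendsto_picard_apply h1 ⟨hs.1.le, hs.2⟩ j).mul (h.tendsto_picard_apply h2 ⟨hs.1.le, hs.2⟩ k)

/-- **Convergence of the nonlinearities** `N(v_n(s), v_n(s))(ξ) → N(v(s), v(s))(ξ)` at a regular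
frequency, `0 < s ≤ T`. [cite: Lemarierieusset2023, §8.8 (PDF p. 208)] -/
theorem FKHyp.tendsto_nonlin_picard (h : FKHyp c T a) {ξ : EuclideanSpace ℝ ι} (hξ : ξ ∈ goodSet c T a)
    {s : ℝ} (hs : s ∈ Ioc 0 T) :
    Tendsto (fun n => nonlin (picard c a n s) (picard c a n s) ξ) atTop
      (𝓝 (nonlin (fkLimit c a s) (fkLimit c a s) ξ)) := by
  rw [tendsto_pi_nhds]
  intro l
  simp only [nonlin_apply]
  refine Tendsto.const_mul _ (tendsto_finsetSum _ fun j _ => tendsto_finsetSum _ fun k _ => ?_)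
  exact Tendsto.const_mul _ (h.tendsto_fconv_picard hξ hs j k)

/-- **Convergence of the Duhamel integrals** at a regular frequency, `0 < t ≤ T` (dominated
convergence in `s`: domination by `C_N ‖ξ‖ (M ⋆ M)(ξ) s^{-1/2}`, integrable on `(0, t]`). [cite: Lemarierieusset2023, §8.8 (PDF p. 208)] -/
theorem FKHyp.tendsto_duhamel_picard (h : FKHyp c T a) {ξ : EuclideanSpace ℝ ι} (hξ : ξ ∈ goodSet c T a)
    {t : ℝ} (ht : t ∈ Ioc 0 T) :
    Tendsto (fun n => ∫ s in Ioc 0 t, heat c ξ (t - s) • nonlin (picard c a n s) (picard c a n s) ξ)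
      atTop (𝓝 (∫ s in Ioc 0 t, heat c ξ (t - s) • nonlin (fkLimit c a s) (fkLimit c a s) ξ)) := by
  set L := lconv (fkEnv c T a) (fkEnv c T a) ξ with hL
  have hCfin : nonlinC ι * ‖ξ‖ₑ * L ≠ ∞ :=
    ENNReal.mul_ne_top (ENNReal.mul_ne_top nonlinC_ne_top enorm_ne_top) hξ.1.ne
  set C : ℝ := (nonlinC ι * ‖ξ‖ₑ * L).toReal with hC
  have hh : Measurable fun s => heat c ξ (t - s) := by
    unfold heat
    fun_prop
  refine tendsto_integral_of_dominated_convergence (fun s => C * s ^ (-(1 / 2 : ℝ))) (fun n => ?_) ?_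
    (fun n => ?_) ?_
  · exact hh.aestronglyMeasurable.smul (measurable_nonlin_picard h.measurable n ξ).aestronglyMeasurable
  · exact ((intervalIntegral.intervalIntegrable_rpow' (a := 0) (b := t)
      (by norm_num : (-1 : ℝ) < -(1 / 2 : ℝ))).1).const_mul C
  · rw [ae_restrict_iff' measurableSet_Ioc]
    refine ae_of_all _ fun s hs => ?_
    have hsT : s ∈ Ioc 0 T := ⟨hs.1, hs.2.trans ht.2⟩
    rw [norm_smul, Real.norm_of_nonneg (heat_nonneg _ _ _)]
    calc heat c ξ (t - s) * ‖nonlin (picard c a n s) (picard c a n s) ξ‖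
        ≤ 1 * ‖nonlin (picard c a n s) (picard c a n s) ξ‖ := by
          gcongr
          exact heat_le_one h.c_pos.le (sub_nonneg.2 hs.2) ξ
      _ = ‖nonlin (picard c a n s) (picard c a n s) ξ‖ := one_mul _
      _ ≤ (nonlinC ι * ‖ξ‖ₑ * (ENNReal.ofReal (s ^ (-(1 / 2 : ℝ))) * L)).toReal :=
          norm_le_toReal_of_enorm_le
            (ENNReal.mul_ne_top (ENNReal.mul_ne_top nonlinC_ne_top enorm_ne_top)
              (ENNReal.mul_ne_top ENNReal.ofReal_ne_top hξ.1.ne))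
            (enorm_nonlin_picard_le h.c_pos h.measurable n hsT ξ)
      _ = C * s ^ (-(1 / 2 : ℝ)) := by
          rw [hC, show nonlinC ι * ‖ξ‖ₑ * (ENNReal.ofReal (s ^ (-(1 / 2 : ℝ))) * L) =
            (nonlinC ι * ‖ξ‖ₑ * L) * ENNReal.ofReal (s ^ (-(1 / 2 : ℝ))) by ring,
            ENNReal.toReal_mul, ENNReal.toReal_ofReal (Real.rpow_nonneg hs.1.le _)]
  · rw [ae_restrict_iff' measurableSet_Ioc]
    exact ae_of_all _ fun s hs =>
      (h.tendsto_nonlin_picard hξ ⟨hs.1, hs.2.trans ht.2⟩).const_smul (heat c ξ (t - s))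

/-- **The limit solves the Duhamel formula** at every regular frequency:
`v(t, ξ) = e^{-c‖ξ‖²t} a(ξ) − ∫_{(0,t]} e^{-c‖ξ‖²(t-s)} N(v(s), v(s))(ξ) ds` for `0 < t ≤ T`
("`U^{[∞]} = U^{[0]} − B(U^{[∞]}, U^{[∞]})`", Lemarié-Rieusset 2023, §8.8, PDF p. 208). [cite: Lemarierieusset2023, §8.8 (PDF p. 208)] -/
theorem FKHyp.fkLimit_eq_duhamel (h : FKHyp c T a) {ξ : EuclideanSpace ℝ ι} (hξ : ξ ∈ goodSet c T a)
    {t : ℝ} (ht : t ∈ Ioc 0 T) :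
    fkLimit c a t ξ = heat c ξ t • a ξ -
      ∫ s in Ioc 0 t, heat c ξ (t - s) • nonlin (fkLimit c a s) (fkLimit c a s) ξ := by
  have h1 : Tendsto (fun n => picard c a (n + 1) t ξ) atTop (𝓝 (fkLimit c a t ξ)) :=
    (h.tendsto_picard hξ ⟨ht.1.le, ht.2⟩).comp (tendsto_add_atTop_nat 1)
  have h2 : Tendsto (fun n => picard c a (n + 1) t ξ) atTop (𝓝 (heat c ξ t • a ξ -
      ∫ s in Ioc 0 t, heat c ξ (t - s) • nonlin (fkLimit c a s) (fkLimit c a s) ξ)) :=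
    tendsto_const_nhds.sub (h.tendsto_duhamel_picard hξ ht)
  exact tendsto_nhds_unique h1 h2

/-! ### Incompressibility and Hermitian symmetry of the limit -/

/-- **Incompressibility of the limit**: `ξ · v(t, ξ) = 0` for a.e. `ξ`, `t ∈ [0, T]`. [cite: Lemarierieusset2023, §8.7 (8.8) (PDF p. 198)] -/
theorem FKHyp.fkLimit_divFree (h : FKHyp c T a)
    (hdiv : ∀ᵐ ξ ∂(volume : Measure (EuclideanSpace ℝ ι)), ∑ j, ((ξ j : ℝ) : ℂ) * a ξ j = 0)
    {t : ℝ} (ht : t ∈ Icc 0 T) :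
    ∀ᵐ ξ ∂(volume : Measure (EuclideanSpace ℝ ι)), ∑ j, ((ξ j : ℝ) : ℂ) * fkLimit c a t ξ j = 0 := by
  have hall : ∀ᵐ ξ ∂(volume : Measure (EuclideanSpace ℝ ι)), ∀ n,
      ∑ j, ((ξ j : ℝ) : ℂ) * picard c a n t ξ j = 0 :=
    ae_all_iff.2 fun n => picard_divFree hdiv n t
  filter_upwards [hall, h.ae_mem_goodSet] with ξ h1 h2
  have hlim : Tendsto (fun n => ∑ j, ((ξ j : ℝ) : ℂ) * picard c a n t ξ j) atTop
      (𝓝 (∑ j, ((ξ j : ℝ) : ℂ) * fkLimit c a t ξ j)) :=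
    tendsto_finsetSum _ fun j _ => (h.tendsto_picard_apply h2 ht j).const_mul _
  rw [show (fun n => ∑ j, ((ξ j : ℝ) : ℂ) * picard c a n t ξ j) = fun _ => 0 from funext h1] at hlim
  exact tendsto_nhds_unique hlim tendsto_const_nhds

/-- **Hermitian symmetry of the limit**: `v(t, -ξ) = conj v(t, ξ)` for a.e. `ξ`, `t ∈ [0, T]`. [folklore] -/
theorem FKHyp.fkLimit_conjSymm (h : FKHyp c T a)
    (hsymm : ∀ᵐ ξ ∂(volume : Measure (EuclideanSpace ℝ ι)), ∀ j, a (-ξ) j = conj (a ξ j))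
    {t : ℝ} (ht : t ∈ Icc 0 T) :
    ∀ᵐ ξ ∂(volume : Measure (EuclideanSpace ℝ ι)), ∀ j, fkLimit c a t (-ξ) j = conj (fkLimit c a t ξ j) := by
  have hall : ∀ᵐ ξ ∂(volume : Measure (EuclideanSpace ℝ ι)), ∀ n, ∀ j,
      picard c a n t (-ξ) j = conj (picard c a n t ξ j) :=
    ae_all_iff.2 fun n => picard_conjSymm hsymm n t
  filter_upwards [hall, h.ae_mem_goodSet, h.ae_neg_mem_goodSet] with ξ h1 h2 h3 j
  have l1 : Tendsto (fun n => picard c a n t (-ξ) j) atTop (𝓝 (fkLimit c a t (-ξ) j)) :=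
    h.tendsto_picard_apply h3 ht j
  have l2 : Tendsto (fun n => conj (picard c a n t ξ j)) atTop (𝓝 (conj (fkLimit c a t ξ j))) :=
    (Complex.continuous_conj.tendsto _).comp (h.tendsto_picard_apply h2 ht j)
  rw [show (fun n => picard c a n t (-ξ) j) = fun n => conj (picard c a n t ξ j) from
    funext fun n => h1 n j] at l1
  exact tendsto_nhds_unique l1 l2

/-! ### Square-integral bounds of the limit -/

omit [DecidableEq ι] in
/-- The free evolution is bounded by the datum: `‖e^{-c‖ξ‖²t} a(ξ)‖ ≤ ‖a(ξ)‖` for `t ≥ 0`. [folklore] -/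
theorem enorm_heat_smul_le (hc : 0 ≤ c) {t : ℝ} (ht : 0 ≤ t) (ξ : EuclideanSpace ℝ ι) :
    ‖heat c ξ t • a ξ‖ₑ ≤ ‖a ξ‖ₑ := by
  rw [enorm_smul, Real.enorm_eq_ofReal (heat_nonneg c ξ t)]
  calc ENNReal.ofReal (heat c ξ t) * ‖a ξ‖ₑ ≤ 1 * ‖a ξ‖ₑ := by
        gcongr
        rw [← ENNReal.ofReal_one]
        exact ENNReal.ofReal_le_ofReal (heat_le_one hc ht ξ)
    _ = ‖a ξ‖ₑ := one_mul _

/-- The `L²`-type pointwise majorant `P = |a| + T^{1/4} κ₂ ‖ξ‖ w (M ⋆ M)` of all `v(t)`,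
`t ∈ [0, T]`. [folklore] -/
def sqMajorant (c T : ℝ) (a : EuclideanSpace ℝ ι → ι → ℂ) (ξ : EuclideanSpace ℝ ι) : ℝ≥0∞ :=
  ‖a ξ‖ₑ + ENNReal.ofReal (T ^ (1 / 4 : ℝ)) *
    (kappa₂ ι c * (‖ξ‖ₑ * weight ξ) * lconv (fkEnv c T a) (fkEnv c T a) ξ)

/-- The `𝓕Ḣ^{1/2}`-type pointwise majorant `P' = |a| + κ₁ (M ⋆ M)` of all `v(t)`, `t ∈ [0, T]`. [folklore] -/
def hsMajorant (c T : ℝ) (a : EuclideanSpace ℝ ι → ι → ℂ) (ξ : EuclideanSpace ℝ ι) : ℝ≥0∞ :=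
  ‖a ξ‖ₑ + kappa₁ ι c * lconv (fkEnv c T a) (fkEnv c T a) ξ

omit [DecidableEq ι] in
/-- `P` is measurable. [folklore] -/
theorem measurable_sqMajorant (ha : Measurable a) (c T : ℝ) : Measurable (sqMajorant c T a) := by
  have hM := measurable_fkEnv ha c T
  exact ha.enorm.add (measurable_const.mul ((measurable_const.mul
    (measurable_id.enorm.mul measurable_weight)).mul (measurable_lconv hM hM)))

omit [DecidableEq ι] in
/-- `P'` is measurable. [folklore] -/
theorem measurable_hsMajorant (ha : Measurable a) (c T : ℝ) : Measurable (hsMajorant c T a) := by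
  have hM := measurable_fkEnv ha c T
  exact ha.enorm.add (measurable_const.mul (measurable_lconv hM hM))

/-- `‖v(t, ξ)‖ ≤ P(ξ)` for a.e. `ξ`, every `t ∈ [0, T]`. [cite: Lemarierieusset2023, §8.8 (PDF p. 209)] -/
theorem FKHyp.enorm_fkLimit_le_sqMajorant (h : FKHyp c T a) {t : ℝ} (ht : t ∈ Icc 0 T) :
    ∀ᵐ ξ ∂(volume : Measure (EuclideanSpace ℝ ι)), ‖fkLimit c a t ξ‖ₑ ≤ sqMajorant c T a ξ := by
  rcases ht.1.eq_or_lt with rfl | ht0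
  · exact ae_of_all _ fun ξ => by rw [fkLimit_zero]; exact le_self_add
  filter_upwards [h.ae_mem_goodSet] with ξ hξ
  calc ‖fkLimit c a t ξ‖ₑ = ‖heat c ξ t • a ξ + (fkLimit c a t ξ - heat c ξ t • a ξ)‖ₑ := by
        rw [add_sub_cancel]
    _ ≤ ‖heat c ξ t • a ξ‖ₑ + ‖fkLimit c a t ξ - heat c ξ t • a ξ‖ₑ := enorm_add_le _ _
    _ ≤ sqMajorant c T a ξ :=
        add_le_add (enorm_heat_smul_le h.c_pos.le ht.1 ξ) (h.enorm_fkLimit_sub_free_le' hξ ⟨ht0, ht.2⟩)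

/-- `‖v(t, ξ)‖ ≤ P'(ξ)` for a.e. `ξ`, every `t ∈ [0, T]`. [cite: Lemarierieusset2023, §8.8 (PDF p. 209)] -/
theorem FKHyp.enorm_fkLimit_le_hsMajorant (h : FKHyp c T a) {t : ℝ} (ht : t ∈ Icc 0 T) :
    ∀ᵐ ξ ∂(volume : Measure (EuclideanSpace ℝ ι)), ‖fkLimit c a t ξ‖ₑ ≤ hsMajorant c T a ξ := by
  rcases ht.1.eq_or_lt with rfl | ht0
  · exact ae_of_all _ fun ξ => by rw [fkLimit_zero]; exact le_self_add
  filter_upwards [h.ae_mem_goodSet] with ξ hξ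
  calc ‖fkLimit c a t ξ‖ₑ = ‖heat c ξ t • a ξ + (fkLimit c a t ξ - heat c ξ t • a ξ)‖ₑ := by
        rw [add_sub_cancel]
    _ ≤ ‖heat c ξ t • a ξ‖ₑ + ‖fkLimit c a t ξ - heat c ξ t • a ξ‖ₑ := enorm_add_le _ _
    _ ≤ hsMajorant c T a ξ :=
        add_le_add (enorm_heat_smul_le h.c_pos.le ht.1 ξ) (h.enorm_fkLimit_sub_free_le hξ ⟨ht0, ht.2⟩)

omit [DecidableEq ι] in
/-- `∫⁻ P² < ∞` (`a ∈ L²` and the product law `‖w (M ⋆ M)‖_F < ∞`). [folklore] -/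
theorem FKHyp.lintegral_sqMajorant_sq_lt_top (h : FKHyp c T a) :
    ∫⁻ ξ, sqMajorant c T a ξ ^ 2 < ∞ := by
  have hM := measurable_fkEnv h.measurable c T
  set Y : EuclideanSpace ℝ ι → ℝ≥0∞ := fun ξ => ENNReal.ofReal (T ^ (1 / 4 : ℝ)) *
    (kappa₂ ι c * (‖ξ‖ₑ * weight ξ) * lconv (fkEnv c T a) (fkEnv c T a) ξ) with hY
  have hYeq : ∀ ξ, Y ξ ^ 2 = (ENNReal.ofReal (T ^ (1 / 4 : ℝ)) * kappa₂ ι c) ^ 2 *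
      (‖ξ‖ₑ ^ 2 * (weight ξ * lconv (fkEnv c T a) (fkEnv c T a) ξ) ^ 2) := fun ξ => by
    rw [hY]; ring
  have hYint : ∫⁻ ξ, Y ξ ^ 2 < ∞ := by
    simp_rw [hYeq]
    rw [lintegral_const_mul' _ _ (ENNReal.pow_ne_top (ENNReal.mul_ne_top ENNReal.ofReal_ne_top
      (kappa₂_ne_top c))), ← fnorm_sq]
    exact ENNReal.mul_lt_top (ENNReal.pow_lt_top (ENNReal.mul_lt_top ENNReal.ofReal_lt_top
      (kappa₂_ne_top c).lt_top)) (ENNReal.pow_lt_top h.fnorm_weight_mul_lconv_lt_top)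
  have hpt : ∀ ξ, sqMajorant c T a ξ ^ 2 ≤ 2 * ‖a ξ‖ₑ ^ 2 + 2 * Y ξ ^ 2 := fun ξ => by
    rw [show sqMajorant c T a ξ = ‖a ξ‖ₑ + Y ξ from rfl, ← mul_add]
    exact ennreal_add_sq_le_two_mul _ _
  have hm1 : Measurable fun ξ : EuclideanSpace ℝ ι => 2 * ‖a ξ‖ₑ ^ 2 :=
    (h.measurable.enorm.pow_const _).const_mul _
  calc ∫⁻ ξ, sqMajorant c T a ξ ^ 2 ≤ ∫⁻ ξ, (2 * ‖a ξ‖ₑ ^ 2 + 2 * Y ξ ^ 2) := lintegral_mono hpt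
    _ = (∫⁻ ξ, 2 * ‖a ξ‖ₑ ^ 2) + ∫⁻ ξ, 2 * Y ξ ^ 2 := lintegral_add_left hm1 _
    _ < ∞ := by
        refine ENNReal.add_lt_top.2 ⟨?_, ?_⟩
        · rw [lintegral_const_mul' _ _ ENNReal.ofNat_ne_top]
          exact ENNReal.mul_lt_top ENNReal.ofNat_lt_top h.sq_lt_top
        · rw [lintegral_const_mul' _ _ ENNReal.ofNat_ne_top]
          exact ENNReal.mul_lt_top ENNReal.ofNat_lt_top hYint

omit [DecidableEq ι] in
/-- `∫⁻ ‖ξ‖ P'² < ∞` (`a ∈ L²(|ξ| dξ)` and the product law `∫⁻ ‖ξ‖ (M ⋆ M)² < ∞`). [folklore] -/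
theorem FKHyp.lintegral_enorm_mul_hsMajorant_sq_lt_top (h : FKHyp c T a) :
    ∫⁻ ξ, ‖ξ‖ₑ * hsMajorant c T a ξ ^ 2 < ∞ := by
  have hM := measurable_fkEnv h.measurable c T
  set L := lconv (fkEnv c T a) (fkEnv c T a) with hL
  have hpt : ∀ ξ, ‖ξ‖ₑ * hsMajorant c T a ξ ^ 2 ≤
      2 * (‖ξ‖ₑ * ‖a ξ‖ₑ ^ 2) + 2 * kappa₁ ι c ^ 2 * (‖ξ‖ₑ * L ξ ^ 2) := fun ξ => by
    rw [show hsMajorant c T a ξ = ‖a ξ‖ₑ + kappa₁ ι c * L ξ from rfl]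
    calc ‖ξ‖ₑ * (‖a ξ‖ₑ + kappa₁ ι c * L ξ) ^ 2
        ≤ ‖ξ‖ₑ * (2 * (‖a ξ‖ₑ ^ 2 + (kappa₁ ι c * L ξ) ^ 2)) :=
          mul_le_mul' le_rfl (ennreal_add_sq_le_two_mul _ _)
      _ = 2 * (‖ξ‖ₑ * ‖a ξ‖ₑ ^ 2) + 2 * kappa₁ ι c ^ 2 * (‖ξ‖ₑ * L ξ ^ 2) := by ring
  have hm1 : Measurable fun ξ : EuclideanSpace ℝ ι => 2 * (‖ξ‖ₑ * ‖a ξ‖ₑ ^ 2) :=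
    (measurable_id.enorm.mul (h.measurable.enorm.pow_const _)).const_mul _
  calc ∫⁻ ξ, ‖ξ‖ₑ * hsMajorant c T a ξ ^ 2
      ≤ ∫⁻ ξ, (2 * (‖ξ‖ₑ * ‖a ξ‖ₑ ^ 2) + 2 * kappa₁ ι c ^ 2 * (‖ξ‖ₑ * L ξ ^ 2)) := lintegral_mono hpt
    _ = (∫⁻ ξ, 2 * (‖ξ‖ₑ * ‖a ξ‖ₑ ^ 2)) + ∫⁻ ξ, 2 * kappa₁ ι c ^ 2 * (‖ξ‖ₑ * L ξ ^ 2) :=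
        lintegral_add_left hm1 _
    _ < ∞ := by
        refine ENNReal.add_lt_top.2 ⟨?_, ?_⟩
        · rw [lintegral_const_mul' _ _ ENNReal.ofNat_ne_top]
          exact ENNReal.mul_lt_top ENNReal.ofNat_lt_top h.weighted_lt_top
        · rw [lintegral_const_mul' _ _ (ENNReal.mul_ne_top ENNReal.ofNat_ne_top
            (ENNReal.pow_ne_top (kappa₁_ne_top c)))]
          exact ENNReal.mul_lt_top (ENNReal.mul_lt_top ENNReal.ofNat_lt_top
            (ENNReal.pow_lt_top (kappa₁_ne_top c).lt_top)) h.lintegral_enorm_mul_lconv_sq_lt_top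

/-- **The uniform `L²` bound**: `∫⁻ ‖v(t)‖² ≤ ∫⁻ P² < ∞` for `t ∈ [0, T]`. [cite: Lemarierieusset2023, Thm. 7.4 (A) (PDF p. 151)] -/
theorem FKHyp.lintegral_sq_le (h : FKHyp c T a) {t : ℝ} (ht : t ∈ Icc 0 T) :
    ∫⁻ ξ, ‖fkLimit c a t ξ‖ₑ ^ 2 ≤ ∫⁻ ξ, sqMajorant c T a ξ ^ 2 :=
  lintegral_mono_ae ((h.enorm_fkLimit_le_sqMajorant ht).mono fun ξ hξ => by gcongr)

/-- **The uniform `𝓕Ḣ^{1/2}` bound**: `∫⁻ ‖ξ‖ ‖v(t)‖² ≤ ∫⁻ ‖ξ‖ P'² < ∞` for `t ∈ [0, T]`. [cite: Lemarierieusset2023, §8.8 (PDF p. 210)] -/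
theorem FKHyp.lintegral_weighted_le (h : FKHyp c T a) {t : ℝ} (ht : t ∈ Icc 0 T) :
    ∫⁻ ξ, ‖ξ‖ₑ * ‖fkLimit c a t ξ‖ₑ ^ 2 ≤ ∫⁻ ξ, ‖ξ‖ₑ * hsMajorant c T a ξ ^ 2 :=
  lintegral_mono_ae ((h.enorm_fkLimit_le_hsMajorant ht).mono fun ξ hξ => by gcongr)

/-- **The Fujita–Kato bound** `∫⁻ ‖ξ‖² ‖v(t)‖² ≤ ‖M‖_F² t^{-1/2}` for `0 < t ≤ T`
(`t^{1/4} u ∈ L^∞ Ḣ¹`, Lemarié-Rieusset 2023, §8.8, PDF p. 210). [cite: Lemarierieusset2023, §8.8 (PDF p. 210)] -/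
theorem FKHyp.lintegral_fujitaKato_le (h : FKHyp c T a) {t : ℝ} (ht : t ∈ Ioc 0 T) :
    ∫⁻ ξ, ‖ξ‖ₑ ^ 2 * ‖fkLimit c a t ξ‖ₑ ^ 2 ≤
      fnorm (fkEnv c T a) ^ 2 * ENNReal.ofReal (t ^ (-(1 / 2 : ℝ))) := by
  calc ∫⁻ ξ, ‖ξ‖ₑ ^ 2 * ‖fkLimit c a t ξ‖ₑ ^ 2
      ≤ ∫⁻ ξ, ENNReal.ofReal (t ^ (-(1 / 4 : ℝ))) ^ 2 * (‖ξ‖ₑ ^ 2 * fkEnv c T a ξ ^ 2) := by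
        refine lintegral_mono_ae ((h.enorm_fkLimit_le_ae t ht).mono fun ξ hξ => ?_)
        calc ‖ξ‖ₑ ^ 2 * ‖fkLimit c a t ξ‖ₑ ^ 2
            ≤ ‖ξ‖ₑ ^ 2 * (ENNReal.ofReal (t ^ (-(1 / 4 : ℝ))) * fkEnv c T a ξ) ^ 2 := by gcongr
          _ = _ := by ring
    _ = fnorm (fkEnv c T a) ^ 2 * ENNReal.ofReal (t ^ (-(1 / 2 : ℝ))) := by
        rw [lintegral_const_mul' _ _ (ENNReal.pow_ne_top ENNReal.ofReal_ne_top), ← fnorm_sq,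
          ofReal_rpow_sq ht.1, mul_comm]
        norm_num

/-! ### Continuity in time -/

omit [DecidableEq ι] in
/-- Continuity in `t` of the truncated Duhamel integrand `t ↦ 1_{(0,t]}(s) e^{-c‖ξ‖²(t-s)} N(s)` at
every `t₀ ≠ s` (the indicator is locally constant there). [folklore] -/
theorem continuousAt_indicator_heat_smul {X : Type*} [TopologicalSpace X] [AddCommMonoid X]
    [Module ℝ X] [ContinuousSMul ℝ X] (c : ℝ) (ξ : EuclideanSpace ℝ ι) (N : ℝ → X) {s t₀ : ℝ} (hst : s ≠ t₀) :
    ContinuousAt (fun t => (Ioc 0 t).indicator (fun s => heat c ξ (t - s) • N s) s) t₀ := by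
  have hh : Continuous fun t : ℝ => heat c ξ (t - s) := by
    unfold heat
    fun_prop
  have hφ : Continuous fun t : ℝ => heat c ξ (t - s) • N s := hh.smul continuous_const
  rcases lt_or_gt_of_ne hst with h | h
  · -- `s < t₀`: near `t₀` the condition `s ≤ t` holds and the indicator is `1_{0 < s}`
    have hev : (fun t => (Ioc 0 t).indicator (fun s => heat c ξ (t - s) • N s) s) =ᶠ[𝓝 t₀]
        fun t => if 0 < s then heat c ξ (t - s) • N s else 0 := by
      filter_upwards [Ioi_mem_nhds h] with t ht
      by_cases hs : 0 < s
      · rw [indicator_of_mem (show s ∈ Ioc 0 t from ⟨hs, le_of_lt ht⟩), if_pos hs]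
      · rw [indicator_of_notMem (fun h' : s ∈ Ioc 0 t => hs h'.1), if_neg hs]
    refine ContinuousAt.congr_of_eventuallyEq ?_ hev
    by_cases hs : 0 < s
    · simp only [if_pos hs]; exact hφ.continuousAt
    · simp only [if_neg hs]; exact continuousAt_const
  · -- `t₀ < s`: near `t₀` the indicator vanishes
    have hev : (fun t => (Ioc 0 t).indicator (fun s => heat c ξ (t - s) • N s) s) =ᶠ[𝓝 t₀]
        fun _ => 0 := by
      filter_upwards [Iio_mem_nhds h] with t ht
      exact indicator_of_notMem (fun h' : s ∈ Ioc 0 t => not_lt.2 h'.2 ht) _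
    exact ContinuousAt.congr_of_eventuallyEq continuousAt_const hev

omit [Fintype ι] [DecidableEq ι] in
/-- Almost every `s` differs from a given `t₀` (Lebesgue measure has no atoms). [folklore] -/
theorem ae_ne_restrict (t₀ : ℝ) (S : Set ℝ) : ∀ᵐ s ∂(volume.restrict S), s ≠ t₀ :=
  ae_restrict_of_ae (by simp [ae_iff])

/-- **Continuity in time of the Duhamel integral** at a regular frequency:
`t ↦ ∫_{(0,T]} 1_{(0,t]}(s) e^{-c‖ξ‖²(t-s)} N(v(s),v(s))(ξ) ds` is continuous on `[0, T]`
(dominated convergence: integrand continuous in `t` for `s ≠ t`, dominated by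
`C_N ‖ξ‖ (M ⋆ M)(ξ) s^{-1/2}`). [folklore] -/
theorem FKHyp.continuousOn_duhamel (h : FKHyp c T a) {ξ : EuclideanSpace ℝ ι} (hξ : ξ ∈ goodSet c T a) :
    ContinuousOn (fun t => ∫ s in Ioc 0 T, (Ioc 0 t).indicator
      (fun s => heat c ξ (t - s) • nonlin (fkLimit c a s) (fkLimit c a s) ξ) s) (Icc 0 T) := by
  intro t₀ _
  set L := lconv (fkEnv c T a) (fkEnv c T a) ξ with hL
  set N : ℝ → ι → ℂ := fun s => nonlin (fkLimit c a s) (fkLimit c a s) ξ with hN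
  have hNm : Measurable N := measurable_nonlin_fkLimit h.measurable c ξ
  set C : ℝ := (nonlinC ι * ‖ξ‖ₑ * L).toReal with hC
  refine continuousWithinAt_of_dominated (bound := fun s => C * s ^ (-(1 / 2 : ℝ))) ?_ ?_ ?_ ?_
  · refine Eventually.of_forall fun t => ?_
    have hh : Measurable fun s => heat c ξ (t - s) := by
      unfold heat
      fun_prop
    exact (hh.aestronglyMeasurable.smul hNm.aestronglyMeasurable).indicator measurableSet_Ioc
  · refine Eventually.of_forall fun t => ?_
    rw [ae_restrict_iff' measurableSet_Ioc]
    refine ae_of_all _ fun s hs => ?_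
    have hbound : ‖N s‖ ≤ C * s ^ (-(1 / 2 : ℝ)) := by
      calc ‖N s‖ ≤ (nonlinC ι * ‖ξ‖ₑ * (ENNReal.ofReal (s ^ (-(1 / 2 : ℝ))) * L)).toReal :=
            norm_le_toReal_of_enorm_le
              (ENNReal.mul_ne_top (ENNReal.mul_ne_top nonlinC_ne_top enorm_ne_top)
                (ENNReal.mul_ne_top ENNReal.ofReal_ne_top hξ.1.ne))
              (h.enorm_nonlin_fkLimit_le hs ξ)
        _ = C * s ^ (-(1 / 2 : ℝ)) := by
            rw [hC, show nonlinC ι * ‖ξ‖ₑ * (ENNReal.ofReal (s ^ (-(1 / 2 : ℝ))) * L) =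
              (nonlinC ι * ‖ξ‖ₑ * L) * ENNReal.ofReal (s ^ (-(1 / 2 : ℝ))) by ring,
              ENNReal.toReal_mul, ENNReal.toReal_ofReal (Real.rpow_nonneg hs.1.le _)]
    by_cases hst : s ∈ Ioc 0 t
    · rw [indicator_of_mem hst, norm_smul, Real.norm_of_nonneg (heat_nonneg _ _ _)]
      calc heat c ξ (t - s) * ‖N s‖ ≤ 1 * ‖N s‖ := by
            gcongr
            exact heat_le_one h.c_pos.le (sub_nonneg.2 hst.2) ξ
        _ ≤ C * s ^ (-(1 / 2 : ℝ)) := by rw [one_mul]; exact hbound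
    · rw [indicator_of_notMem hst, norm_zero]
      exact (norm_nonneg _).trans hbound
  · exact ((intervalIntegral.intervalIntegrable_rpow' (a := 0) (b := T)
      (by norm_num : (-1 : ℝ) < -(1 / 2 : ℝ))).1).const_mul C
  · filter_upwards [ae_ne_restrict t₀ (Ioc 0 T)] with s hs
    exact (continuousAt_indicator_heat_smul c ξ N hs).continuousWithinAt

/-- The Duhamel integral over `(0, t]` as an integral over the fixed interval `(0, T]`. [folklore] -/
theorem setIntegral_Ioc_eq_indicator {X : Type*} [NormedAddCommGroup X] [NormedSpace ℝ X]
    (F : ℝ → X) {t : ℝ} (ht : t ≤ T) :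
    ∫ s in Ioc 0 t, F s = ∫ s in Ioc 0 T, (Ioc 0 t).indicator F s := by
  rw [setIntegral_indicator measurableSet_Ioc, Ioc_inter_Ioc, sup_idem, min_eq_right ht]

/-- **Continuity in time of the limit at a regular frequency**: `t ↦ v(t, ξ)` is continuous on
`[0, T]` (the free evolution is continuous and the Duhamel integral is continuous in `t`). [folklore] -/
theorem FKHyp.continuousOn_fkLimit (h : FKHyp c T a) {ξ : EuclideanSpace ℝ ι} (hξ : ξ ∈ goodSet c T a) :
    ContinuousOn (fun t => fkLimit c a t ξ) (Icc 0 T) := by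
  have hh : Continuous fun t : ℝ => heat c ξ t := by
    unfold heat
    fun_prop
  have hfree : Continuous fun t : ℝ => heat c ξ t • a ξ := hh.smul continuous_const
  refine (hfree.continuousOn.sub (h.continuousOn_duhamel hξ)).congr fun t ht => ?_
  -- the Duhamel identity on `[0, T]`, written over the fixed interval
  simp only [Pi.sub_apply]
  rcases ht.1.eq_or_lt with rfl | ht0
  · simp
  · rw [h.fkLimit_eq_duhamel hξ ⟨ht0, ht.2⟩, setIntegral_Ioc_eq_indicator _ ht.2]

/-- **Continuity in `L²(dξ)`** on `[0, T]`: `∫⁻ ‖v(t) − v(t₀)‖² → 0` as `t → t₀` within `[0, T]`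
(dominated convergence: pointwise continuity at regular frequencies, domination by `(2P)²`). [cite: Lemarierieusset2023, Thm. 7.4 (A) (PDF p. 151)] -/
theorem FKHyp.tendsto_lintegral_sq_sub (h : FKHyp c T a) {t₀ : ℝ} (ht₀ : t₀ ∈ Icc 0 T) :
    Tendsto (fun t => ∫⁻ ξ, ‖fkLimit c a t ξ - fkLimit c a t₀ ξ‖ₑ ^ 2) (𝓝[Icc 0 T] t₀) (𝓝 0) := by
  have hm : ∀ t, Measurable fun ξ => ‖fkLimit c a t ξ - fkLimit c a t₀ ξ‖ₑ ^ 2 := fun t =>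
    ((measurable_fkLimit_slice h.measurable c t).sub (measurable_fkLimit_slice h.measurable c t₀)).enorm.pow_const _
  have h := tendsto_lintegral_filter_of_dominated_convergence
    (μ := (volume : Measure (EuclideanSpace ℝ ι))) (l := 𝓝[Icc 0 T] t₀)
    (F := fun t ξ => ‖fkLimit c a t ξ - fkLimit c a t₀ ξ‖ₑ ^ 2) (f := fun _ => 0)
    (fun ξ => (sqMajorant c T a ξ + sqMajorant c T a ξ) ^ 2)
    (Eventually.of_forall hm) ?_ ?_ ?_
  · simpa using h
  · filter_upwards [eventually_mem_nhdsWithin] with t ht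
    filter_upwards [h.enorm_fkLimit_le_sqMajorant ht, h.enorm_fkLimit_le_sqMajorant ht₀] with ξ h1 h2
    calc ‖fkLimit c a t ξ - fkLimit c a t₀ ξ‖ₑ ^ 2
        ≤ (‖fkLimit c a t ξ‖ₑ + ‖fkLimit c a t₀ ξ‖ₑ) ^ 2 := by gcongr; exact enorm_sub_le
      _ ≤ (sqMajorant c T a ξ + sqMajorant c T a ξ) ^ 2 := by gcongr
  · refine ne_of_lt ?_
    calc ∫⁻ ξ, (sqMajorant c T a ξ + sqMajorant c T a ξ) ^ 2 = ∫⁻ ξ, 4 * sqMajorant c T a ξ ^ 2 :=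
          lintegral_congr fun ξ => by ring
      _ = 4 * ∫⁻ ξ, sqMajorant c T a ξ ^ 2 := lintegral_const_mul' _ _ ENNReal.ofNat_ne_top
      _ < ∞ := ENNReal.mul_lt_top ENNReal.ofNat_lt_top h.lintegral_sqMajorant_sq_lt_top
  · filter_upwards [h.ae_mem_goodSet] with ξ hξ
    have hc : ContinuousWithinAt (fun t => fkLimit c a t ξ) (Icc 0 T) t₀ := h.continuousOn_fkLimit hξ t₀ ht₀
    have h1 : Tendsto (fun t => fkLimit c a t ξ - fkLimit c a t₀ ξ) (𝓝[Icc 0 T] t₀) (𝓝 0) := by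
      simpa using hc.tendsto.sub (tendsto_const_nhds (x := fkLimit c a t₀ ξ))
    simpa using ENNReal.Tendsto.pow (n := 2) h1.enorm

/-- **Continuity in `L²(|ξ| dξ)`** on `[0, T]`: `∫⁻ ‖ξ‖ ‖v(t) − v(t₀)‖² → 0` as `t → t₀` within
`[0, T]` (domination by `‖ξ‖ (2P')²`). [cite: Lemarierieusset2023, Thm. 7.4 (A) (PDF p. 151)] -/
theorem FKHyp.tendsto_lintegral_weighted_sub (h : FKHyp c T a) {t₀ : ℝ} (ht₀ : t₀ ∈ Icc 0 T) :
    Tendsto (fun t => ∫⁻ ξ, ‖ξ‖ₑ * ‖fkLimit c a t ξ - fkLimit c a t₀ ξ‖ₑ ^ 2) (𝓝[Icc 0 T] t₀) (𝓝 0) := by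
  have hm : ∀ t, Measurable fun ξ => ‖ξ‖ₑ * ‖fkLimit c a t ξ - fkLimit c a t₀ ξ‖ₑ ^ 2 := fun t =>
    measurable_id.enorm.mul (((measurable_fkLimit_slice h.measurable c t).sub
      (measurable_fkLimit_slice h.measurable c t₀)).enorm.pow_const _)
  have h := tendsto_lintegral_filter_of_dominated_convergence
    (μ := (volume : Measure (EuclideanSpace ℝ ι))) (l := 𝓝[Icc 0 T] t₀)
    (F := fun t ξ => ‖ξ‖ₑ * ‖fkLimit c a t ξ - fkLimit c a t₀ ξ‖ₑ ^ 2) (f := fun _ => 0)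
    (fun ξ => ‖ξ‖ₑ * (hsMajorant c T a ξ + hsMajorant c T a ξ) ^ 2)
    (Eventually.of_forall hm) ?_ ?_ ?_
  · simpa using h
  · filter_upwards [eventually_mem_nhdsWithin] with t ht
    filter_upwards [h.enorm_fkLimit_le_hsMajorant ht, h.enorm_fkLimit_le_hsMajorant ht₀] with ξ h1 h2
    gcongr ‖ξ‖ₑ * ?_
    calc ‖fkLimit c a t ξ - fkLimit c a t₀ ξ‖ₑ ^ 2
        ≤ (‖fkLimit c a t ξ‖ₑ + ‖fkLimit c a t₀ ξ‖ₑ) ^ 2 := by gcongr; exact enorm_sub_le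
      _ ≤ (hsMajorant c T a ξ + hsMajorant c T a ξ) ^ 2 := by gcongr
  · refine ne_of_lt ?_
    calc ∫⁻ ξ, ‖ξ‖ₑ * (hsMajorant c T a ξ + hsMajorant c T a ξ) ^ 2
          = ∫⁻ ξ, 4 * (‖ξ‖ₑ * hsMajorant c T a ξ ^ 2) := lintegral_congr fun ξ => by ring
      _ = 4 * ∫⁻ ξ, ‖ξ‖ₑ * hsMajorant c T a ξ ^ 2 := lintegral_const_mul' _ _ ENNReal.ofNat_ne_top
      _ < ∞ := ENNReal.mul_lt_top ENNReal.ofNat_lt_top h.lintegral_enorm_mul_hsMajorant_sq_lt_top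
  · filter_upwards [h.ae_mem_goodSet] with ξ hξ
    have hc : ContinuousWithinAt (fun t => fkLimit c a t ξ) (Icc 0 T) t₀ := h.continuousOn_fkLimit hξ t₀ ht₀
    have h1 : Tendsto (fun t => fkLimit c a t ξ - fkLimit c a t₀ ξ) (𝓝[Icc 0 T] t₀) (𝓝 0) := by
      simpa using hc.tendsto.sub (tendsto_const_nhds (x := fkLimit c a t₀ ξ))
    have h2 : Tendsto (fun t => ‖fkLimit c a t ξ - fkLimit c a t₀ ξ‖ₑ ^ 2) (𝓝[Icc 0 T] t₀) (𝓝 0) := by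
      simpa using ENNReal.Tendsto.pow (n := 2) h1.enorm
    simpa using ENNReal.Tendsto.const_mul h2 (Or.inr enorm_ne_top)

end Limit

/-! ### Assembly: `fourier_fujitaKato_local` -/

section Assembly

/-- Local notation for frequency space `ℝ³ = EuclideanSpace ℝ (Fin 3)`. -/
local notation "ℝ³" => EuclideanSpace ℝ (Fin 3)

/-- **The limit is a Fourier-side Navier–Stokes solution in the Fujita–Kato class** on `[0, T]`
(all fields of `IsFourierNSSolution`, from the lemmas of this file). [cite: Lemarierieusset2023, §8.8 (PDF pp. 207–210)] -/
theorem FKHyp.isFourierNSSolution {c T : ℝ} {a : ℝ³ → Fin 3 → ℂ} (h : FKHyp c T a)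
    (hdiv : ∀ᵐ ξ : ℝ³ ∂volume, ∑ j, ((ξ j : ℝ) : ℂ) * a ξ j = 0)
    (hsymm : ∀ᵐ ξ : ℝ³ ∂volume, ∀ j, a (-ξ) j = conj (a ξ j)) :
    IsFourierNSSolution c T a (fkLimit c a) where
  measurable := measurable_fkLimit h.measurable c
  initial := fkLimit_zero
  duhamel := fun t ht => by
    rcases ht.1.eq_or_lt with rfl | ht0
    · exact ae_of_all _ fun ξ => by simp
    · filter_upwards [h.ae_mem_goodSet] with ξ hξ
      rw [intervalIntegral.integral_of_le ht.1]
      exact h.fkLimit_eq_duhamel hξ ⟨ht0, ht.2⟩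
  divFree := fun _ ht => h.fkLimit_divFree hdiv ht
  conjSymm := fun _ ht => h.fkLimit_conjSymm hsymm ht
  sq_le := ⟨(∫⁻ ξ, sqMajorant c T a ξ ^ 2).toNNReal, fun t ht => by
    rw [ENNReal.coe_toNNReal h.lintegral_sqMajorant_sq_lt_top.ne]
    exact h.lintegral_sq_le ht⟩
  weighted_lt_top := fun _ ht =>
    lt_of_le_of_lt (h.lintegral_weighted_le ht) h.lintegral_enorm_mul_hsMajorant_sq_lt_top
  fujitaKato := ⟨(fnorm (fkEnv c T a) ^ 2).toNNReal, fun t ht => by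
    rw [ENNReal.coe_toNNReal (ENNReal.pow_ne_top h.fnorm_fkEnv_lt_top.ne)]
    exact h.lintegral_fujitaKato_le ht⟩
  tendsto_sq := fun _ ht₀ => h.tendsto_lintegral_sq_sub ht₀
  tendsto_weighted := fun _ ht₀ => h.tendsto_lintegral_weighted_sub ht₀

/-- **Fujita–Kato local existence on the Fourier side** (discharge of the named fact
`fourier_fujitaKato_local` of `FujitaKatoLocal.lean`; Lemarié-Rieusset 2023, §8.8, the statement
preceding Thm. 8.20, PDF p. 210, finite-energy transcription): for a rate `c > 0` and measurable
Fourier data `a ∈ L²(dξ) ∩ L²(|ξ| dξ)`, incompressible and Hermitian almost everywhere, there are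
`T > 0` (any `T` with `8 κ(c) K ‖initEnv c T a‖_F ≤ 1`, `exists_small_time`) and a Fourier-side
solution in the Fujita–Kato class on `[0, T]` starting at `a`, namely the limit `fkLimit c a` of
the dominated Picard iteration. [cite: Lemarierieusset2023, §8.8 (PDF p. 210) and Thm. 7.4 (A)] -/
theorem fourier_fujitaKato_local_holds : fourier_fujitaKato_local := by
  intro c hc a ha hsq hw hdiv hsymm
  have hfin : 8 * kappa (Fin 3) c * plK (Fin 3) ≠ ∞ :=
    ENNReal.mul_ne_top (ENNReal.mul_ne_top (by norm_num) (kappa_ne_top c)) plK_ne_top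
  obtain ⟨T, hT, hsmall⟩ := exists_small_time hc ha hw
    (δ := (8 * kappa (Fin 3) c * plK (Fin 3))⁻¹) (ENNReal.inv_pos.2 hfin)
  have h : FKHyp c T a :=
    { finrank_eq := finrank_euclideanSpace_fin
      c_pos := hc
      T_pos := hT
      measurable := ha
      sq_lt_top := hsq
      weighted_lt_top := hw
      small := (mul_le_mul' le_rfl hsmall).trans (ENNReal.mul_inv_le_one _) }
  exact ⟨T, hT, fkLimit c a, h.isFourierNSSolution hdiv hsymm⟩

end Assembly

end Literature.Analysis.FluidPDE.FujitaKato
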